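import Literature.InformationTheory.QuantumCodes.StabilizerDistanceHardness
import Literature.InformationTheory.QuantumCodes.StabilizerDistance
import HarnessLib

/-!
# Kapshikar–Kundu 2023, Theorem 2: QMD is in `NP`, hence NP-complete (stabilizer-generator input)

Companion of `MinimumDistanceHardness.lean` (the language `QMINDIST`) and `StabilizerDistanceHardness.lean`
(`KapshikarKundu2023_quantumMinimumDistance_isNPHard_holds`). Kapshikar–Kundu print "QMD is NP-complete"
(§4 Thm. 2, for the codeword-stabilized input) and remark "Like MD, it is easy to see that QMD is in NP"
(§3, after Problem 4); the named fact of the tree records only NP-HARDNESS for the stabilizer-generator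
input `S ∈ 𝔽₂^{r × 2n}` because membership for that input is not spelled out in print. This file supplies
it, so that "QMD is NP-complete" is a theorem of the tree for the standard input:

* `QMinDistNP.V` — the verifier, in the algebra of `FP` string bricks (no machine is written). On
  `⟨x, c⟩` with `c = ⟨⟨a, b⟩, ⟨a', b'⟩⟩` it checks `T` (`x` is the canonical code
  `⟨⟨bin r, ⟨bin n, ⟨1ʳ, rows⟩⟩⟩, bin t⟩` of an instance: `x` equals the re-encoding of its own fields, the
  rows re-listed by a concatenation fold of `nthItemFn`, plus the row-length tests) and then EITHER the
  row-free case (`r = 0`: a yes-instance iff `n ≥ 1` and `t ≥ 1`, decided without a certificate — such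
  codes carry `n` only in binary, so no polynomial certificate could name an error) OR, for `r ≥ 1`: the
  certificate shape (`|a| = |b| = |a'| = |b'| = n`), that the rows pairwise commute (a double `allIdxFn`
  of symplectic parities, each a sum fold), that the error `w = (a|b)` commutes with every row, that the
  DUAL WITNESS `u = (a'|b')` commutes with every row but not with `w` — which certifies `w ∉ S̄` without
  Gaussian elimination and is complete because `S̄⊥⊥ = S̄` (`sympDual_sympDual`) — and that the weight of
  `w` is `≤ t` (a sum fold compared in binary);
* `QMinDistNP.QMINDIST_mem_NP : QMINDIST ∈ NP` (certificate of length `≤ 9|x| + 8`);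
* **`KapshikarKundu2023_quantumMinimumDistance_isNPComplete : IsNPComplete QMINDIST`** — with the hardness
  half `KapshikarKundu2023_quantumMinimumDistance_isNPHard_holds`.

## References

* [KapshikarKundu2023] U. Kapshikar, S. Kundu, *On the hardness of the minimum distance problem of
  quantum codes*, IEEE Trans. Inform. Theory 69 (2023) 6293–6302 = arXiv:2203.04262 (held:
  `paper:arxiv-2203.04262`): §2.2.1 (symplectic input), §3 Problem 4 and the remark after it (chunk p0010
  L57: "Like MD, it is easy to see that QMD is in NP"), §4 Theorem 2 (chunk p0014: "QMD is NP-complete").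
* [CalderbankEtAl1998] A. R. Calderbank, E. M. Rains, P. W. Shor, N. J. A. Sloane, IEEE Trans. Inform.
  Theory 44 (1998) 1369–1387, §2 Thm. 1 (the symplectic language).
* [AroraBarak2009] S. Arora, B. Barak, *Computational Complexity*, CUP 2009, Def. 2.1 (NP via
  certificates), §1.3, §0.1.

## Mathlib / tree search

`lean search 'QMINDIST.*NP|quantumMinimumDistance.*NP'` (2026-08-27): nothing. Pattern and bricks reused
from `Coding/CosetWeightsNPComplete.lean` (instance test by re-encoding, sum folds `Brick.foldLoop addFn`,
`allIdxFn`, `mem_P_of_mem_FP`), `sympDual_sympDual` from `SymplecticCodes.lean`.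
-/

noncomputable section

namespace Literature.InformationTheory.QuantumCodes

open _root_.Computability Literature.Computability.Complexity Literature.InformationTheory.Coding
open scoped Literature.Computability.Complexity.Notation

namespace QMinDistNP

open Polynomial Brick HashBricks Plumb

/-! ### Small facts -/

/-- Parity is the first bit of a numeral. [folklore] -/
private theorem headD_encodeNat (s : ℕ) : (encodeNat s).headD false = decide (s % 2 = 1) := by
  have hv := bitsToNat_encodeNat s
  rcases h : encodeNat s with _ | ⟨b, l⟩
  · rw [h, bitsToNat_nil] at hv
    subst hv
    rfl
  · rw [h, bitsToNat_cons] at hv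
    rw [List.headD_cons, ← hv]
    cases b <;> simp [Nat.add_mul_mod_self_left]

/-- A bit string is the table of its own bits. [folklore] -/
private theorem ofFn_getD {n : ℕ} {l : List Bool} (hl : l.length = n) :
    (List.ofFn fun j : Fin n => l.getD j false) = l := by
  subst hl
  apply List.ext_getElem (by simp)
  intro i h1 h2
  rw [List.getElem_ofFn, List.getD_eq_getElem]

/-- The framed body of a list code is the concatenation of one-item frames. [folklore] -/
private theorem frames_ofFn_eq_ccat (c : ℕ → List Bool) (n : ℕ) :
    frames (List.ofFn fun i : Fin n => c i) = ccat (fun i => boolPair (c i) []) n := by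
  rw [frames_ofFn]
  exact ccat_congr fun i _ => by rw [boolPair_eq, List.append_nil]

/-- First projections do not lengthen. [folklore] -/
private theorem length_fstF_le (z : List Bool) : (fstF z).length ≤ z.length := by
  have := length_fstF_sndF_le z; omega

/-- Second projections do not lengthen. [folklore] -/
private theorem length_sndF_le (z : List Bool) : (sndF z).length ≤ z.length := by
  have := length_fstF_sndF_le z; omega

/-- A concatenation is at least as long as its first piece. [folklore] -/
private theorem length_le_length_ccat (g : ℕ → List Bool) {k : ℕ} (hk : 0 < k) : (g 0).length ≤ (ccat g k).length := by
  induction k with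
  | zero => omega
  | succ k ih =>
    rw [ccat_succ, List.length_append]
    rcases Nat.eq_zero_or_pos k with rfl | hk'
    · simp
    · exact (ih hk').trans (Nat.le_add_right _ _)

/-- The code of an `𝔽₂`-vector given by a Boolean table. [cite: AroraBarak2009, §0.1] -/
private theorem encode_boolVec {K : ℕ} (g : Fin K → Bool) :
    (encodingF2Vec K).encode (fun u => if g u then (1 : ZMod 2) else 0) = List.ofFn g := by
  show (List.ofFn fun u : Fin K => decide ((if g u then (1 : ZMod 2) else 0) = 1)) = _
  congr 1
  funext u
  cases g u <;> decide

/-- Every element of `𝔽₂` is the indicator of being `1`. [folklore] -/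
private theorem zmod2_eq_ite (a : ZMod 2) : a = if decide (a = 1) = true then 1 else 0 := by
  revert a; decide

/-! ### Fields of an instance string `x = ⟨⟨rn, ⟨nn, ⟨ur, R⟩⟩⟩, tn⟩` -/

/-- `r = ⟦fstF (fstF x)⟧`, the number of rows. [folklore] -/
def rOf (x : List Bool) : ℕ := bitsToNat (fstF (fstF x))
/-- `n = ⟦fstF (sndF (fstF x))⟧`, the number of qubits. [folklore] -/
def nOf (x : List Bool) : ℕ := bitsToNat (fstF (sndF (fstF x)))
/-- `t = ⟦sndF x⟧`, the weight bound. [folklore] -/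
def tOf (x : List Bool) : ℕ := bitsToNat (sndF x)
/-- The framed rows `R`. [folklore] -/
def ROf (x : List Bool) : List Bool := sndF (sndF (sndF (fstF x)))
/-- Row `i` of `R` (the pair code `⟨aᵢ, bᵢ⟩`; junk past the end). [folklore] -/
def item (x : List Bool) (i : ℕ) : List Bool := fstF (sndF^[i] (ROf x))
/-- The X-part bits `aᵢ` of row `i`. [cite: KapshikarKundu2023, §2.2.1 (rows (a|b))] -/
def aIt (x : List Bool) (i : ℕ) : List Bool := fstF (item x i)
/-- The Z-part bits `bᵢ` of row `i`. [cite: KapshikarKundu2023, §2.2.1 (rows (a|b))] -/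
def bIt (x : List Bool) (i : ℕ) : List Bool := sndF (item x i)
/-- `r` clamped by `|x|` (the loop bound; `= r` on codes). [folklore] -/
def rhat (x : List Bool) : ℕ := min (rOf x) x.length
/-- `n` clamped by `|x|`. [folklore] -/
def nhat (x : List Bool) : ℕ := min (nOf x) x.length

/-- The `𝔽₂`-vector of a bit table read up to length `K`. [cite: AroraBarak2009, §0.1] -/
def vecOf (K : ℕ) (l : List Bool) : Fin K → ZMod 2 := fun k => if l.getD k false then 1 else 0

/-- The code of the vector of a bit table is the table, cut to length. [cite: AroraBarak2009, §0.1] -/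
theorem encode_vecOf (K : ℕ) (l : List Bool) :
    (encodingF2Vec K).encode (vecOf K l) = List.ofFn fun k : Fin K => l.getD k false :=
  encode_boolVec _

/-- The symplectic vector `(a|b)` of two bit tables. [cite: KapshikarKundu2023, §2.2.1] -/
def svecOf (K : ℕ) (a b : List Bool) : SympVec K := (vecOf K a, vecOf K b)

/-- The rows read off `x`. [cite: KapshikarKundu2023, §2.2.1] -/
def rowsOf (x : List Bool) : Fin (rOf x) → SympVec (nOf x) := fun i => svecOf (nOf x) (aIt x i) (bIt x i)

/-- The instance read off `x`. [cite: KapshikarKundu2023, §3 Problem 4] -/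
def instOf (x : List Bool) : (Σ r : ℕ, Σ n : ℕ, Fin r → SympVec n) × ℕ := (⟨rOf x, nOf x, rowsOf x⟩, tOf x)

/-- **The re-encoding of the fields of `x`** (with the clamped `r`). [cite: AroraBarak2009, §0.1] -/
def reb (x : List Bool) : List Bool :=
  boolPair (boolPair (encodeNat (rOf x)) (boolPair (encodeNat (nOf x))
    (boolPair (ones (rhat x)) (ccat (fun i => boolPair (boolPair (aIt x i) (bIt x i)) []) (rhat x)))))
    (encodeNat (tOf x))

/-- **`x` is the canonical code of an instance**: it equals its own re-encoding and both parts of every row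
have length `n`. [cite: AroraBarak2009, §0.1] -/
def GoodShape (x : List Bool) : Prop :=
  x = reb x ∧ ∀ i < rhat x, (aIt x i).length = nhat x ∧ (bIt x i).length = nhat x

/-- Rows are parts of `x`. [folklore] -/
private theorem length_item_le (x : List Bool) (i : ℕ) : (item x i).length ≤ x.length := by
  unfold item ROf
  refine (length_fstF_le _).trans ((length_sndF_iterate_le i _).trans ?_)
  exact (length_sndF_le _).trans ((length_sndF_le _).trans ((length_sndF_le _).trans (length_fstF_le _)))

/-- X-parts are parts of `x`. [folklore] -/
private theorem length_aIt_le (x : List Bool) (i : ℕ) : (aIt x i).length ≤ x.length :=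
  (length_fstF_le _).trans (length_item_le x i)

/-- Z-parts are parts of `x`. [folklore] -/
private theorem length_bIt_le (x : List Bool) (i : ℕ) : (bIt x i).length ≤ x.length :=
  (length_sndF_le _).trans (length_item_le x i)

/-- `rhat ≤ |x|`. [folklore] -/
private theorem rhat_le (x : List Bool) : rhat x ≤ x.length := Nat.min_le_right _ _

/-- `nhat ≤ |x|`. [folklore] -/
private theorem nhat_le (x : List Bool) : nhat x ≤ x.length := Nat.min_le_right _ _

/-- **On a good shape the clamps are off**: `rhat = r`, and `nhat = n` as soon as there is a row.
[cite: AroraBarak2009, §0.1 (representing objects as strings)] -/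
theorem clamps_of_goodShape {x : List Bool} (h : GoodShape x) : rhat x = rOf x ∧ (0 < rhat x → nhat x = nOf x) := by
  obtain ⟨hx, hrows⟩ := h
  have hlen := congrArg List.length hx
  simp only [reb, length_boolPair, List.length_replicate] at hlen
  refine ⟨by unfold rhat at *; omega, fun hr => ?_⟩
  have h0 := (hrows 0 hr).1
  have hc := length_le_length_ccat (fun i => boolPair (boolPair (aIt x i) (bIt x i)) []) hr
  simp only [length_boolPair, List.length_nil] at hc
  unfold nhat at *
  omega

/-- **A good-shaped string is the code of the instance read off it.** [cite: AroraBarak2009, §0.1] -/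
theorem encode_instOf {x : List Bool} (h : GoodShape x) :
    (encodingSympRows.pairBool encodingNatBool).encode (instOf x) = x := by
  obtain ⟨hr, hn⟩ := clamps_of_goodShape h
  obtain ⟨hx, hrows⟩ := h
  conv_rhs => rw [hx]
  show boolPair (boolPair (encodeNat (rOf x)) (boolPair (encodeNat (nOf x))
    ((encodingFinVec ((encodingF2Vec (nOf x)).pairBool (encodingF2Vec (nOf x))) (rOf x)).encode (rowsOf x)))) (encodeNat (tOf x)) = _
  rw [reb, finVec_encode_eq, ← boolPair_eq, OracleCompose.unaryEncodeNat_eq_replicate, hr, ← frames_ofFn_eq_ccat]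
  congr 5
  refine List.ofFn_inj.2 (funext fun i => ?_)
  have hi : (i : ℕ) < rhat x := by rw [hr]; exact i.2
  obtain ⟨ha, hb⟩ := hrows i hi
  rw [hn (by omega)] at ha hb
  show boolPair ((encodingF2Vec (nOf x)).encode (vecOf (nOf x) (aIt x i))) ((encodingF2Vec (nOf x)).encode (vecOf (nOf x) (bIt x i))) = _
  rw [encode_vecOf, encode_vecOf, ofFn_getD ha, ofFn_getD hb]

/-! ### Codes of instances are good-shaped -/

section Code

variable (I : (Σ r : ℕ, Σ n : ℕ, Fin r → SympVec n) × ℕ)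

/-- The code of row `i` as a function on `ℕ` (junk `[]` past the end). [cite: AroraBarak2009, §0.1] -/
def rowCode (i : ℕ) : List Bool :=
  (List.ofFn fun i : Fin I.1.1 => ((encodingF2Vec I.1.2.1).pairBool (encodingF2Vec I.1.2.1)).encode (I.1.2.2 i)).getD i []

/-- The code of an instance, spelled out. [cite: AroraBarak2009, §0.1] -/
theorem encode_eq :
    (encodingSympRows.pairBool encodingNatBool).encode I =
      boolPair (boolPair (encodeNat I.1.1) (boolPair (encodeNat I.1.2.1)
        (boolPair (ones I.1.1) (ccat (fun t => boolPair (rowCode I t) []) I.1.1)))) (encodeNat I.2) := by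
  obtain ⟨⟨r, n, rows⟩, t⟩ := I
  show boolPair (boolPair (encodeNat r) (boolPair (encodeNat n)
    ((encodingFinVec ((encodingF2Vec n).pairBool (encodingF2Vec n)) r).encode rows))) (encodeNat t) = _
  rw [finVec_encode_eq, ← boolPair_eq, OracleCompose.unaryEncodeNat_eq_replicate, ← frames_ofFn_eq_ccat]
  congr 5
  refine List.ofFn_inj.2 (funext fun i => ?_)
  rw [rowCode, List.getD_eq_getElem _ _ (by simp), List.getElem_ofFn]

/-- The fields of a code. [cite: AroraBarak2009, §0.1] -/
theorem fields_encode :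
    rOf ((encodingSympRows.pairBool encodingNatBool).encode I) = I.1.1 ∧
    nOf ((encodingSympRows.pairBool encodingNatBool).encode I) = I.1.2.1 ∧
    tOf ((encodingSympRows.pairBool encodingNatBool).encode I) = I.2 ∧
    ROf ((encodingSympRows.pairBool encodingNatBool).encode I) = ccat (fun t => boolPair (rowCode I t) []) I.1.1 := by
  simp only [rOf, nOf, tOf, ROf, encode_eq, fstF_boolPair, sndF_boolPair, bitsToNat_encodeNat, and_self]

/-- The rows of a code. [cite: AroraBarak2009, §0.1] -/
theorem item_encode (t : ℕ) : item ((encodingSympRows.pairBool encodingNatBool).encode I) t = rowCode I t := by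
  rw [item, (fields_encode I).2.2.2, ccat_frame_eq_encList, sndF_iterate_encList, fstF_encList]
  by_cases ht : t < I.1.1
  · have h1 : ((List.range I.1.1).map (rowCode I)).drop t = rowCode I t :: ((List.range I.1.1).map (rowCode I)).drop (t + 1) := by
      rw [← List.getElem_cons_drop (by simpa using ht)]
      simp
    rw [h1, List.headD_cons]
  · rw [List.drop_eq_nil_of_le (by simpa using Nat.le_of_not_lt ht), List.headD_nil, rowCode,
      List.getD_eq_default _ _ (by rw [List.length_ofFn]; exact Nat.le_of_not_lt ht)]

/-- The code of a row in range. [cite: AroraBarak2009, §0.1] -/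
theorem rowCode_of_lt (i : Fin I.1.1) :
    rowCode I i = boolPair ((encodingF2Vec I.1.2.1).encode (I.1.2.2 i).1) ((encodingF2Vec I.1.2.1).encode (I.1.2.2 i).2) := by
  rw [rowCode, List.getD_eq_getElem _ _ (by simp), List.getElem_ofFn]
  rfl

/-- Length of a vector code. [folklore] -/
private theorem length_encode_vec {n : ℕ} (v : Fin n → ZMod 2) : ((encodingF2Vec n).encode v).length = n := by
  show (List.ofFn _).length = _; rw [List.length_ofFn]

/-- `r ≤ |code|`. [folklore] -/
private theorem r_le_length_encode : I.1.1 ≤ ((encodingSympRows.pairBool encodingNatBool).encode I).length := by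
  rw [encode_eq]; simp only [length_boolPair, List.length_replicate]; omega

/-- `n ≤ |code|` when there is a row. [folklore] -/
private theorem n_le_length_encode (hr : 0 < I.1.1) : I.1.2.1 ≤ ((encodingSympRows.pairBool encodingNatBool).encode I).length := by
  have hc := length_le_length_ccat (fun t => boolPair (rowCode I t) []) hr
  have h0 : rowCode I 0 = rowCode I ((⟨0, hr⟩ : Fin I.1.1) : ℕ) := rfl
  rw [h0, rowCode_of_lt] at hc
  simp only [length_boolPair, List.length_nil, length_encode_vec] at hc
  rw [encode_eq]; simp only [length_boolPair, List.length_replicate]; omega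

/-- The clamps on a code. [cite: AroraBarak2009, §0.1 (representing objects as strings)] -/
theorem clamps_encode :
    rhat ((encodingSympRows.pairBool encodingNatBool).encode I) = I.1.1 ∧
    (0 < I.1.1 → nhat ((encodingSympRows.pairBool encodingNatBool).encode I) = I.1.2.1) := by
  refine ⟨?_, fun hr => ?_⟩
  · rw [rhat, (fields_encode I).1, Nat.min_eq_left (r_le_length_encode I)]
  · rw [nhat, (fields_encode I).2.1, Nat.min_eq_left (n_le_length_encode I hr)]

/-- **Codes are good-shaped.** [cite: AroraBarak2009, §0.1] -/
theorem goodShape_encode : GoodShape ((encodingSympRows.pairBool encodingNatBool).encode I) := by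
  obtain ⟨hm, hn⟩ := clamps_encode I
  obtain ⟨h1, h2, h3, h4⟩ := fields_encode I
  refine ⟨?_, fun t ht => ?_⟩
  · have hc : ccat (fun t => boolPair (boolPair (aIt ((encodingSympRows.pairBool encodingNatBool).encode I) t)
        (bIt ((encodingSympRows.pairBool encodingNatBool).encode I) t)) []) I.1.1 = ccat (fun t => boolPair (rowCode I t) []) I.1.1 :=
      ccat_congr fun t ht => by
        rw [aIt, bIt, item_encode, rowCode_of_lt I ⟨t, ht⟩, fstF_boolPair, sndF_boolPair]
    rw [reb, h1, h2, h3, hm, hc, ← encode_eq]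
  · rw [hm] at ht
    rw [hn (by omega), aIt, bIt, item_encode, rowCode_of_lt I ⟨t, ht⟩, fstF_boolPair, sndF_boolPair, length_encode_vec,
      length_encode_vec]
    exact ⟨rfl, rfl⟩

end Code

/-! ### The instance test `T` (bricks) -/

/-- On `x`: the numeral `rn`. [folklore] -/
def rnF : List Bool → List Bool := fstF ∘ fstF
/-- On `x`: the numeral `nn`. [folklore] -/
def nnF : List Bool → List Bool := fstF ∘ sndF ∘ fstF
/-- On `x`: the framed rows `R`. [folklore] -/
def RF : List Bool → List Bool := sndF ∘ sndF ∘ sndF ∘ fstF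
/-- On `x`: `1^{rhat}`. [folklore] -/
def rhatF : List Bool → List Bool := binToUnaryFn ∘ fanoutFn id rnF
/-- On `x`: `1^{nhat}`. [folklore] -/
def nhatF : List Bool → List Bool := binToUnaryFn ∘ fanoutFn id nnF
/-- On `⟨x, 1ⁱ⟩`: row `i`. [folklore] -/
def itemF : List Bool → List Bool := nthItemFn ∘ fanoutFn sndF (RF ∘ fstF)
/-- On `⟨x, 1ⁱ⟩`: the framed row `⟨⟨aᵢ, bᵢ⟩, ε⟩`. [folklore] -/
def rowPieceF : List Bool → List Bool := fanoutFn (fanoutFn (fstF ∘ itemF) (sndF ∘ itemF)) (fun _ => [])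
/-- On `x`: the re-listed rows (concatenation fold over `i < rhat`). [cite: AroraBarak2009, §1.3 (bounded loops)] -/
def rrebF : List Bool → List Bool := foldCat (6 * X + 6) X rowPieceF ∘ fanoutFn id rhatF
/-- On `x`: **the re-encoding** `reb x`. [cite: AroraBarak2009, §0.1] -/
def rebF : List Bool → List Bool :=
  fanoutFn (fanoutFn (norm ∘ rnF) (fanoutFn (norm ∘ nnF) (fanoutFn rhatF rrebF))) (norm ∘ sndF)
/-- On `x`: `[x = reb x]`. [folklore] -/
def t0 : List Bool → List Bool := eqPairFn ∘ fanoutFn id rebF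
/-- On `⟨x, 1ⁱ⟩`: `[|aᵢ| = nhat ∧ |bᵢ| = nhat]`. [folklore] -/
def cLen : List Bool → List Bool :=
  andFn (eqPairFn ∘ fanoutFn (onesFn ∘ fstF ∘ itemF) (nhatF ∘ fstF)) (eqPairFn ∘ fanoutFn (onesFn ∘ sndF ∘ itemF) (nhatF ∘ fstF))
/-- On `x`: all rows have parts of length `nhat`. [folklore] -/
def t2 : List Bool → List Bool := allIdxFn rhatF cLen
/-- **The instance test** on `x`. [cite: AroraBarak2009, §0.1] -/
def T : List Bool → List Bool := andFn t0 t2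

/-- `rhatF ∈ FP`. [cite: AroraBarak2009, §1.3 (polynomial time is closed under composition)] -/
theorem rhatF_mem_FP : rhatF ∈ FP :=
  comp_mem_FP binToUnaryFn_mem_FP (fanoutFn_mem_FP OracleCompose.id_mem_FP (comp_mem_FP fstF_mem_FP fstF_mem_FP))

/-- `nhatF ∈ FP`. [cite: AroraBarak2009, §1.3 (polynomial time is closed under composition)] -/
theorem nhatF_mem_FP : nhatF ∈ FP :=
  comp_mem_FP binToUnaryFn_mem_FP (fanoutFn_mem_FP OracleCompose.id_mem_FP
    (comp_mem_FP fstF_mem_FP (comp_mem_FP sndF_mem_FP fstF_mem_FP)))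

/-- `RF ∈ FP`. [cite: AroraBarak2009, §1.3 (polynomial time is closed under composition)] -/
theorem RF_mem_FP : RF ∈ FP :=
  comp_mem_FP sndF_mem_FP (comp_mem_FP sndF_mem_FP (comp_mem_FP sndF_mem_FP fstF_mem_FP))

/-- `itemF ∈ FP`. [cite: AroraBarak2009, §1.3 (polynomial time is closed under composition)] -/
theorem itemF_mem_FP : itemF ∈ FP :=
  comp_mem_FP nthItemFn_mem_FP (fanoutFn_mem_FP sndF_mem_FP (comp_mem_FP RF_mem_FP fstF_mem_FP))

/-- `rowPieceF ∈ FP`. [cite: AroraBarak2009, §1.3 (polynomial time is closed under composition)] -/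
theorem rowPieceF_mem_FP : rowPieceF ∈ FP :=
  fanoutFn_mem_FP (fanoutFn_mem_FP (comp_mem_FP fstF_mem_FP itemF_mem_FP) (comp_mem_FP sndF_mem_FP itemF_mem_FP)) (const_mem_FP _)

/-- `rebF ∈ FP`. [cite: AroraBarak2009, §1.3 (polynomial time is closed under composition and bounded loops)] -/
theorem rebF_mem_FP : rebF ∈ FP := by
  have hr : rrebF ∈ FP := comp_mem_FP (foldCat_mem_FP _ _ rowPieceF_mem_FP) (fanoutFn_mem_FP OracleCompose.id_mem_FP rhatF_mem_FP)
  exact fanoutFn_mem_FP (fanoutFn_mem_FP (comp_mem_FP norm_mem_FP (comp_mem_FP fstF_mem_FP fstF_mem_FP))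
    (fanoutFn_mem_FP (comp_mem_FP norm_mem_FP (comp_mem_FP fstF_mem_FP (comp_mem_FP sndF_mem_FP fstF_mem_FP)))
      (fanoutFn_mem_FP rhatF_mem_FP hr))) (comp_mem_FP norm_mem_FP sndF_mem_FP)

/-- `cLen ∈ FP`. [cite: AroraBarak2009, §1.3 (polynomial time is closed under composition)] -/
theorem cLen_mem_FP : cLen ∈ FP :=
  andFn_mem_FP (comp_mem_FP eqPairFn_mem_FP (fanoutFn_mem_FP (comp_mem_FP onesFn_mem_FP (comp_mem_FP fstF_mem_FP itemF_mem_FP))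
      (comp_mem_FP nhatF_mem_FP fstF_mem_FP)))
    (comp_mem_FP eqPairFn_mem_FP (fanoutFn_mem_FP (comp_mem_FP onesFn_mem_FP (comp_mem_FP sndF_mem_FP itemF_mem_FP))
      (comp_mem_FP nhatF_mem_FP fstF_mem_FP)))

/-- `cLen` is one-bit. [cite: AroraBarak2009, §1.3 (polynomial time is closed under composition)] -/
theorem oneBit_cLen : OneBit cLen := oneBit_andFn (oneBit_eqPairFn.comp _) (oneBit_eqPairFn.comp _)

/-- **`T ∈ FP`.** [cite: AroraBarak2009, §1.3 (polynomial time is closed under composition and bounded loops)] -/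
theorem T_mem_FP : T ∈ FP :=
  andFn_mem_FP (comp_mem_FP eqPairFn_mem_FP (fanoutFn_mem_FP OracleCompose.id_mem_FP rebF_mem_FP))
    (allIdxFn_mem_FP rhatF_mem_FP cLen_mem_FP oneBit_cLen)

/-- Value of `rhatF`. [cite: AroraBarak2009, §1.3 (arithmetic on unary counters)] -/
theorem rhatF_apply (x : List Bool) : rhatF x = ones (rhat x) := by
  rw [rhatF, Function.comp_apply, fanoutFn_apply, binToUnaryFn_boolPair]; rfl

/-- Value of `nhatF`. [cite: AroraBarak2009, §1.3 (arithmetic on unary counters)] -/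
theorem nhatF_apply (x : List Bool) : nhatF x = ones (nhat x) := by
  rw [nhatF, Function.comp_apply, fanoutFn_apply, binToUnaryFn_boolPair]; rfl

/-- Value of `itemF`. [cite: AroraBarak2009, §1.3 (loops)] -/
theorem itemF_apply (x : List Bool) (i : ℕ) : itemF (boolPair x (ones i)) = item x i := by
  rw [itemF, Function.comp_apply, fanoutFn_apply, sndF_boolPair, Function.comp_apply, fstF_boolPair, nthItemFn_boolPair,
    List.length_replicate]; rfl

/-- `T` is one-bit. [cite: AroraBarak2009, §1.3 (polynomial time is closed under composition)] -/
theorem oneBit_T : OneBit T := by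
  refine oneBit_andFn (oneBit_eqPairFn.comp _) (oneBit_allIdxFn oneBit_cLen fun u => ?_)
  rw [rhatF_apply, List.length_replicate]
  exact rhat_le u

/-- Value of `rowPieceF`. [folklore] -/
private theorem rowPieceF_apply (x : List Bool) (i : ℕ) :
    rowPieceF (boolPair x (ones i)) = boolPair (boolPair (aIt x i) (bIt x i)) [] := by
  rw [rowPieceF, fanoutFn_apply, fanoutFn_apply, Function.comp_apply, Function.comp_apply, itemF_apply]; rfl

/-- Value of `rebF`. [folklore] -/
private theorem rebF_apply (x : List Bool) : rebF x = reb x := by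
  have hr : rrebF x = ccat (fun i => boolPair (boolPair (aIt x i) (bIt x i)) []) (rhat x) := by
    rw [rrebF, Function.comp_apply, fanoutFn_apply, rhatF_apply, id,
      foldCat_apply (by rw [List.length_replicate, eval_X]; exact rhat_le x)
        (fun i _ => by
          rw [rowPieceF_apply, length_boolPair, length_boolPair, List.length_nil]
          simp only [eval_add, eval_mul, eval_ofNat, eval_X]
          have := length_aIt_le x i; have := length_bIt_le x i; omega), List.length_replicate]
    exact ccat_congr fun i _ => by rw [rowPieceF_apply]
  simp only [rebF, fanoutFn_apply, Function.comp_apply, norm_eq_encodeNat, rhatF_apply, hr, reb, rnF, nnF, rOf, nOf, tOf]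

/-- `1ᵃ = 1ᵇ ↔ a = b`. [folklore] -/
private theorem decide_ones_eq_ones (a b : ℕ) : decide (ones a = ones b) = decide (a = b) :=
  decide_eq_decide.2 ⟨fun h => by simpa [ones] using congrArg List.length h, fun h => h ▸ rfl⟩

/-- `1ᵃ = ε ↔ a = 0`. [folklore] -/
private theorem decide_ones_eq_nil (a : ℕ) : decide (ones a = []) = decide (a = 0) := by
  cases a <;> simp [ones, List.replicate_succ]

/-- Value of `cLen`. [folklore] -/
private theorem cLen_apply (x : List Bool) (i : ℕ) :
    cLen (boolPair x (ones i)) = [decide ((aIt x i).length = nhat x) && decide ((bIt x i).length = nhat x)] := by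
  have h1 : (eqPairFn ∘ fanoutFn (onesFn ∘ fstF ∘ itemF) (nhatF ∘ fstF)) (boolPair x (ones i)) =
      [decide ((aIt x i).length = nhat x)] := by
    rw [Function.comp_apply, fanoutFn_apply, Function.comp_apply, Function.comp_apply, itemF_apply, ThreeDMNP.onesFn_eq_ones,
      Function.comp_apply, fstF_boolPair, nhatF_apply, eqPairFn_boolPair, decide_ones_eq_ones, aIt]
  have h2 : (eqPairFn ∘ fanoutFn (onesFn ∘ sndF ∘ itemF) (nhatF ∘ fstF)) (boolPair x (ones i)) =
      [decide ((bIt x i).length = nhat x)] := by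
    rw [Function.comp_apply, fanoutFn_apply, Function.comp_apply, Function.comp_apply, itemF_apply, ThreeDMNP.onesFn_eq_ones,
      Function.comp_apply, fstF_boolPair, nhatF_apply, eqPairFn_boolPair, decide_ones_eq_ones, bIt]
  rw [cLen, andFn_apply h1 h2]

/-- **Truth of the instance test.** [cite: AroraBarak2009, §0.1] -/
theorem T_eq_true_iff (x : List Bool) : T x = [true] ↔ GoodShape x := by
  have h0 : t0 x = [decide (x = reb x)] := by
    rw [t0, Function.comp_apply, fanoutFn_apply, rebF_apply, eqPairFn_boolPair]; rfl
  have h2 : t2 x = [decide (∀ i < rhat x, (aIt x i).length = nhat x ∧ (bIt x i).length = nhat x)] := by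
    rw [t2, allIdxFn_apply oneBit_cLen (h := rhatF) (by rw [rhatF_apply, List.length_replicate]; exact rhat_le x),
      rhatF_apply, List.length_replicate]
    simp [cLen_apply]
  rw [T, andFn_apply h0 h2, GoodShape]
  simp [Bool.and_eq_true, decide_eq_true_eq]

/-! ### Symplectic parities and weights of bit tables -/

/-- The symplectic pairing of `(p₁|p₂)` and `(q₁|q₂)` accumulated over `ℕ`: `Σ_{k<K} [p₁ₖq₂ₖ ⊕ q₁ₖp₂ₖ]`
(its parity is the symplectic inner product). [cite: CalderbankEtAl1998, §2 eq. (1) (printed p. 4)] -/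
def spNat (p₁ p₂ q₁ q₂ : List Bool) (K : ℕ) : ℕ :=
  ∑ k ∈ Finset.range K, (xor (p₁.getD k false && q₂.getD k false) (q₁.getD k false && p₂.getD k false)).toNat

/-- The weight of `(a|b)` accumulated over `ℕ`: the number of `k < K` with `aₖ ∨ bₖ`. [cite: CalderbankEtAl1998, §2 (printed p. 4, weight of (a|b))] -/
def wtNat (a b : List Bool) (K : ℕ) : ℕ := ∑ k ∈ Finset.range K, (a.getD k false || b.getD k false).toNat

/-- `Bool.toNat` as an indicator. [folklore] -/
private theorem toNat_eq_ite (b : Bool) : b.toNat = if b = true then 1 else 0 := by cases b <;> rfl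

/-- Residues mod `2` as elements of `𝔽₂`. [folklore] -/
private theorem natCast_eq_ite_iff (S : ℕ) (b : Bool) :
    ((S : ZMod 2) = if b = true then 1 else 0) ↔ decide (S % 2 = 1) = b := by
  rw [← ZMod.natCast_mod S 2]
  have h := Nat.mod_lt S two_pos
  interval_cases hS : S % 2 <;> cases b <;> simp

/-- In `𝔽₂`, the exclusive or is the sum and the conjunction the product of indicators. [folklore] -/
private theorem cast_toNat_xor_and (p q r s : Bool) :
    (((xor (p && q) (r && s)).toNat : ℕ) : ZMod 2) =
      (if p = true then (1 : ZMod 2) else 0) * (if q = true then 1 else 0) +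
        (if r = true then (1 : ZMod 2) else 0) * (if s = true then 1 else 0) := by
  cases p <;> cases q <;> cases r <;> cases s <;> decide

/-- **The accumulated pairing is the symplectic inner product** (in `𝔽₂`). [cite: CalderbankEtAl1998, §2 eq. (1) (printed p. 4)] -/
theorem spNat_cast (p₁ p₂ q₁ q₂ : List Bool) (K : ℕ) :
    (spNat p₁ p₂ q₁ q₂ K : ZMod 2) = sympInner (svecOf K p₁ p₂) (svecOf K q₁ q₂) := by
  rw [spNat, Nat.cast_sum, sympInner, dotProduct, dotProduct, ← Finset.sum_add_distrib,
    ← Fin.sum_univ_eq_sum_range (fun k => (((xor (p₁.getD k false && q₂.getD k false)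
      (q₁.getD k false && p₂.getD k false)).toNat : ℕ) : ZMod 2)) K]
  refine Finset.sum_congr rfl fun k _ => ?_
  rw [cast_toNat_xor_and]
  simp only [svecOf, vecOf]

/-- The symplectic inner product vanishes iff the accumulated pairing is even. [cite: CalderbankEtAl1998, §2 eq. (1) (printed p. 4)] -/
theorem sympInner_svecOf_eq_zero_iff (p₁ p₂ q₁ q₂ : List Bool) (K : ℕ) :
    sympInner (svecOf K p₁ p₂) (svecOf K q₁ q₂) = 0 ↔ decide (spNat p₁ p₂ q₁ q₂ K % 2 = 1) = false := by
  rw [← spNat_cast, ← natCast_eq_ite_iff]; simp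

/-- The symplectic inner product is `1` iff the accumulated pairing is odd. [cite: CalderbankEtAl1998, §2 eq. (1) (printed p. 4)] -/
theorem sympInner_svecOf_ne_zero_iff (p₁ p₂ q₁ q₂ : List Bool) (K : ℕ) :
    sympInner (svecOf K p₁ p₂) (svecOf K q₁ q₂) ≠ 0 ↔ decide (spNat p₁ p₂ q₁ q₂ K % 2 = 1) = true := by
  rw [Ne, sympInner_svecOf_eq_zero_iff]; simp

/-- A range sum of bit indicators is the number of set positions. [folklore] -/
private theorem sum_range_toNat_eq_card (k : ℕ) (P : ℕ → Bool) :
    ∑ i ∈ Finset.range k, (P i).toNat = ((Finset.univ : Finset (Fin k)).filter fun i : Fin k => P (i : ℕ) = true).card := by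
  rw [← Fin.sum_univ_eq_sum_range (fun i => (P i).toNat) k, Finset.card_filter]
  exact Finset.sum_congr rfl fun i _ => toNat_eq_ite _

/-- **The accumulated weight is the symplectic weight.** [cite: CalderbankEtAl1998, §2 (printed p. 4, weight of (a|b))] -/
theorem wtNat_eq_sympWeight (a b : List Bool) (K : ℕ) : wtNat a b K = sympWeight (svecOf K a b) := by
  rw [wtNat, sum_range_toNat_eq_card, sympWeight]
  congr 1
  ext i
  simp only [Finset.mem_filter, Finset.mem_univ, true_and, svecOf, vecOf]
  cases a.getD i false <;> cases b.getD i false <;> simp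

/-- The bit table of an `𝔽₂`-vector. [cite: AroraBarak2009, §0.1] -/
def bitsOf {K : ℕ} (v : Fin K → ZMod 2) : List Bool := List.ofFn fun k => decide (v k = 1)

/-- Length of a bit table. [cite: AroraBarak2009, §0.1] -/
@[simp] theorem length_bitsOf {K : ℕ} (v : Fin K → ZMod 2) : (bitsOf v).length = K := by rw [bitsOf, List.length_ofFn]

/-- Reading back a bit table. [cite: AroraBarak2009, §0.1] -/
@[simp] theorem vecOf_bitsOf {K : ℕ} (v : Fin K → ZMod 2) : vecOf K (bitsOf v) = v := by
  funext k
  rw [vecOf, bitsOf, List.getD_eq_getElem _ _ (by simp), List.getElem_ofFn]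
  exact (zmod2_eq_ite (v k)).symm

/-- Reading back a symplectic vector. [cite: KapshikarKundu2023, §2.2.1] -/
@[simp] theorem svecOf_bitsOf {K : ℕ} (w : SympVec K) : svecOf K (bitsOf w.1) (bitsOf w.2) = w :=
  Prod.ext (vecOf_bitsOf w.1) (vecOf_bitsOf w.2)

/-- The code of a vector is its bit table. [cite: AroraBarak2009, §0.1] -/
theorem encode_eq_bitsOf {K : ℕ} (v : Fin K → ZMod 2) : (encodingF2Vec K).encode v = bitsOf v := rfl

/-! ### Generic symplectic-parity brick -/

section Parity

variable (gx gP gQ : List Bool → List Bool)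

/-- On `⟨ctx, 1ᵏ⟩`: bit `k` of the component `h` of the pair string `g ctx`. [folklore] -/
def bitK (h g : List Bool → List Bool) : List Bool → List Bool := headBitFn ∘ bitAtFn ∘ fanoutFn sndF (h ∘ g ∘ fstF)
/-- On `⟨ctx, 1ᵏ⟩`: `[p₁ₖq₂ₖ ⊕ q₁ₖp₂ₖ]` for `⟨p₁,p₂⟩ = gP ctx`, `⟨q₁,q₂⟩ = gQ ctx`. [cite: CalderbankEtAl1998, §2 eq. (1) (printed p. 4)] -/
def spBit : List Bool → List Bool := xorFn (andFn (bitK fstF gP) (bitK sndF gQ)) (andFn (bitK fstF gQ) (bitK sndF gP))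
/-- On `ctx`: the fold record `⟨ctx, ⟨bin nhat(gx ctx), ⟨1⁰, bin 0⟩⟩⟩`. [folklore] -/
def spInit : List Bool → List Bool := fanoutFn id (fanoutFn (lenBinF ∘ nhatF ∘ gx) (fun _ => boolPair [] []))
/-- On `ctx`: the numeral of the accumulated pairing (sum fold over `k < nhat`). [cite: AroraBarak2009, §1.3 (bounded loops)] -/
def spSum : List Bool → List Bool := sndPow 2 ∘ foldLoop addFn (spBit gP gQ) X ∘ spInit gx
/-- On `ctx`: `[pairing is odd]` = the symplectic inner product bit. [cite: CalderbankEtAl1998, §2 eq. (1) (printed p. 4)] -/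
def spPar : List Bool → List Bool := headBitFn ∘ spSum gx gP gQ

variable {gx gP gQ}

/-- `bitK h g ∈ FP`. [cite: AroraBarak2009, §1.3 (polynomial time is closed under composition)] -/
theorem bitK_mem_FP {h g : List Bool → List Bool} (hh : h ∈ FP) (hg : g ∈ FP) : bitK h g ∈ FP :=
  comp_mem_FP headBitFn_mem_FP (comp_mem_FP bitAtFn_mem_FP (fanoutFn_mem_FP sndF_mem_FP (comp_mem_FP hh (comp_mem_FP hg fstF_mem_FP))))

/-- `spBit ∈ FP`. [cite: AroraBarak2009, §1.3 (polynomial time is closed under composition)] -/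
theorem spBit_mem_FP (hP : gP ∈ FP) (hQ : gQ ∈ FP) : spBit gP gQ ∈ FP :=
  xorFn_mem_FP (andFn_mem_FP (bitK_mem_FP fstF_mem_FP hP) (bitK_mem_FP sndF_mem_FP hQ))
    (andFn_mem_FP (bitK_mem_FP fstF_mem_FP hQ) (bitK_mem_FP sndF_mem_FP hP))

/-- `spBit` is one-bit. [cite: AroraBarak2009, §1.3 (polynomial time is closed under composition)] -/
theorem oneBit_spBit : OneBit (spBit gP gQ) :=
  oneBit_xorFn (oneBit_andFn (oneBit_headBitFn.comp _) (oneBit_headBitFn.comp _))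
    (oneBit_andFn (oneBit_headBitFn.comp _) (oneBit_headBitFn.comp _))

/-- One-bit functions have linear growth. [folklore] -/
private theorem length_le_of_oneBit {f : List Bool → List Bool} (hf : OneBit f) (z : List Bool) :
    (f z).length ≤ 1 * ((fstF z).length + 1) := by
  rw [hf.length_eq]; omega

/-- `spSum ∈ FP`. [cite: AroraBarak2009, §1.3 (polynomial time is closed under composition and bounded loops)] -/
theorem spSum_mem_FP (hx : gx ∈ FP) (hP : gP ∈ FP) (hQ : gQ ∈ FP) : spSum gx gP gQ ∈ FP :=
  comp_mem_FP (sndPow_mem_FP 2) (comp_mem_FP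
    (foldLoop_mem_FP addFn_mem_FP length_addFn_le (spBit_mem_FP hP hQ) (length_le_of_oneBit oneBit_spBit) X)
    (fanoutFn_mem_FP OracleCompose.id_mem_FP (fanoutFn_mem_FP
      (comp_mem_FP lenBinF_mem_FP (comp_mem_FP nhatF_mem_FP hx)) (const_mem_FP _))))

/-- `spPar ∈ FP`. [cite: AroraBarak2009, §1.3 (polynomial time is closed under composition and bounded loops)] -/
theorem spPar_mem_FP (hx : gx ∈ FP) (hP : gP ∈ FP) (hQ : gQ ∈ FP) : spPar gx gP gQ ∈ FP :=
  comp_mem_FP headBitFn_mem_FP (spSum_mem_FP hx hP hQ)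

/-- `spPar` is one-bit. [cite: AroraBarak2009, §1.3 (polynomial time is closed under composition)] -/
theorem oneBit_spPar : OneBit (spPar gx gP gQ) := oneBit_headBitFn.comp _

/-- A single bit as a numeral. [folklore] -/
private theorem bitsToNat_single (b : Bool) : bitsToNat [b] = b.toNat := by
  rw [bitsToNat_cons, bitsToNat_nil]; omega

/-- Value of `bitK`. [folklore] -/
private theorem bitK_apply (h g : List Bool → List Bool) (ctx : List Bool) (k : ℕ) :
    bitK h g (boolPair ctx (ones k)) = [(h (g ctx)).getD k false] := by
  simp only [bitK, Function.comp_apply, fanoutFn_apply, sndF_boolPair, fstF_boolPair, bitAtFn_boolPair,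
    List.length_replicate, headBitFn_apply, ThreeDMNP.headD_take_drop]

/-- Value of `spBit`. [cite: CalderbankEtAl1998, §2 eq. (1) (printed p. 4)] -/
theorem spBit_apply (ctx : List Bool) (k : ℕ) :
    spBit gP gQ (boolPair ctx (ones k)) = [xor ((fstF (gP ctx)).getD k false && (sndF (gQ ctx)).getD k false)
      ((fstF (gQ ctx)).getD k false && (sndF (gP ctx)).getD k false)] := by
  rw [spBit, xorFn_apply (andFn_apply (bitK_apply _ _ ctx k) (bitK_apply _ _ ctx k))
    (andFn_apply (bitK_apply _ _ ctx k) (bitK_apply _ _ ctx k))]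

/-- **Value of `spSum`**: the numeral of the accumulated pairing over `k < nhat (gx ctx)`, when the context
determines an input no longer than itself. [cite: CalderbankEtAl1998, §2 eq. (1) (printed p. 4)] -/
theorem spSum_apply (ctx : List Bool) (hctx : nhat (gx ctx) ≤ ctx.length) :
    spSum gx gP gQ ctx = encodeNat (spNat (fstF (gP ctx)) (sndF (gP ctx)) (fstF (gQ ctx)) (sndF (gQ ctx)) (nhat (gx ctx))) := by
  have hinit : spInit gx ctx = boolPair ctx (boolPair (encodeNat (nhat (gx ctx))) (boolPair (ones 0) (encodeNat 0))) := by
    simp only [spInit, fanoutFn_apply, id, Function.comp_apply, nhatF_apply, lenBinF_apply, List.length_replicate]; rfl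
  have hk : nhat (gx ctx) ≤ (X : Polynomial ℕ).eval ctx.length := by rw [eval_X]; exact hctx
  rw [spSum, Function.comp_apply, Function.comp_apply, hinit, foldLoop_apply addFn (spBit gP gQ) hk 0 (encodeNat 0),
    foldAcc_addFn]
  simp only [sndPow, Function.comp_apply, sndF_boolPair, Nat.zero_add, spBit_apply, bitsToNat_single, spNat]

/-- **Value of `spPar`.** [cite: CalderbankEtAl1998, §2 eq. (1) (printed p. 4)] -/
theorem spPar_apply (ctx : List Bool) (hctx : nhat (gx ctx) ≤ ctx.length) :
    spPar gx gP gQ ctx =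
      [decide (spNat (fstF (gP ctx)) (sndF (gP ctx)) (fstF (gQ ctx)) (sndF (gQ ctx)) (nhat (gx ctx)) % 2 = 1)] := by
  rw [spPar, Function.comp_apply, spSum_apply ctx hctx, headBitFn_apply, headD_encodeNat]

end Parity

/-! ### The verifier (bricks) on `u = ⟨x, ⟨⟨a, b⟩, ⟨a', b'⟩⟩⟩` -/

/-- On `u`: the error part `⟨a, b⟩` of the certificate. [folklore] -/
def wF : List Bool → List Bool := fstF ∘ sndF
/-- On `u`: the dual-witness part `⟨a', b'⟩` of the certificate. [folklore] -/
def vF : List Bool → List Bool := sndF ∘ sndF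
/-- On `u`: `[|g u| = nhat x]`. [folklore] -/
def lenOk (g : List Bool → List Bool) : List Bool → List Bool := eqPairFn ∘ fanoutFn (onesFn ∘ g) (nhatF ∘ fstF)
/-- On `u`: the certificate shape `|a| = |b| = |a'| = |b'| = nhat`. [folklore] -/
def W1 : List Bool → List Bool :=
  andFn (lenOk (fstF ∘ wF)) (andFn (lenOk (sndF ∘ wF)) (andFn (lenOk (fstF ∘ vF)) (lenOk (sndF ∘ vF))))
/-- On `u`: the row-free case `r = 0 ∧ 0 < n ∧ 0 < t`. [cite: KapshikarKundu2023, §3 Problem 4] -/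
def Z0 : List Bool → List Bool :=
  andFn (eqPairFn ∘ fanoutFn (rhatF ∘ fstF) (fun _ => []))
    (andFn (ltFn ∘ fanoutFn (fun _ => []) (nnF ∘ fstF)) (ltFn ∘ fanoutFn (fun _ => []) (sndF ∘ fstF)))
/-- On `u`: `[r ≠ 0]`. [folklore] -/
def R1 : List Bool → List Bool := notFn (eqPairFn ∘ fanoutFn (rhatF ∘ fstF) (fun _ => []))
/-- On `⟨⟨u, 1ⁱ⟩, 1ʲ⟩`: `[row i commutes with row j]`. [cite: KapshikarKundu2023, §2.2.1] -/
def soBit : List Bool → List Bool :=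
  notFn (spPar (fstF ∘ fstF ∘ fstF) (itemF ∘ fanoutFn (fstF ∘ fstF ∘ fstF) (sndF ∘ fstF))
    (itemF ∘ fanoutFn (fstF ∘ fstF ∘ fstF) sndF))
/-- On `u`: all pairs of rows commute. [cite: KapshikarKundu2023, §2.2.1 ("S … (n−k)×2n", a stabilizer group is abelian)] -/
def SO : List Bool → List Bool := allIdxFn (rhatF ∘ fstF) (allIdxFn (rhatF ∘ fstF ∘ fstF) soBit)
/-- On `⟨u, 1ⁱ⟩`: `[row i commutes with the error w]`. [cite: KapshikarKundu2023, §3 Problem 4 (undetectable error)] -/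
def dBit : List Bool → List Bool :=
  notFn (spPar (fstF ∘ fstF) (itemF ∘ fanoutFn (fstF ∘ fstF) sndF) (wF ∘ fstF))
/-- On `u`: the error commutes with every row. [cite: KapshikarKundu2023, §3 Problem 4] -/
def D : List Bool → List Bool := allIdxFn (rhatF ∘ fstF) dBit
/-- On `⟨u, 1ⁱ⟩`: `[row i commutes with the dual witness u]`. [folklore] -/
def uBit : List Bool → List Bool :=
  notFn (spPar (fstF ∘ fstF) (itemF ∘ fanoutFn (fstF ∘ fstF) sndF) (vF ∘ fstF))
/-- On `u`: the dual witness commutes with every row. [folklore] -/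
def U : List Bool → List Bool := allIdxFn (rhatF ∘ fstF) uBit
/-- On `u`: the dual witness does NOT commute with the error (so the error is outside the stabilizer span). [folklore] -/
def UW : List Bool → List Bool := spPar fstF vF wF
/-- On `⟨u, 1ᵏ⟩`: `[aₖ ∨ bₖ]`. [cite: CalderbankEtAl1998, §2 (printed p. 4, weight of (a|b))] -/
def wtBit : List Bool → List Bool := orFn (bitK fstF wF) (bitK sndF wF)
/-- On `u`: the numeral of the weight of the error (sum fold). [cite: AroraBarak2009, §1.3 (bounded loops)] -/
def wtSum : List Bool → List Bool := sndPow 2 ∘ foldLoop addFn wtBit X ∘ spInit fstF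
/-- On `u`: `[weight ≤ t]`. [cite: KapshikarKundu2023, §3 Problem 4 ("of weight ≤ t")] -/
def WT : List Bool → List Bool := notFn (ltFn ∘ fanoutFn (sndF ∘ fstF) wtSum)
/-- **The verifier** `V = T ∧ (Z0 ∨ (R1 ∧ W1 ∧ SO ∧ D ∧ U ∧ UW ∧ WT))` on `u = ⟨x, c⟩`.
[cite: KapshikarKundu2023, §3 (after Problem 4: "Like MD, it is easy to see that QMD is in NP")] -/
def V : List Bool → List Bool :=
  andFn (T ∘ fstF) (orFn Z0 (andFn R1 (andFn W1 (andFn SO (andFn D (andFn U (andFn UW WT)))))))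

/-- `lenOk g ∈ FP`. [cite: AroraBarak2009, §1.3 (polynomial time is closed under composition)] -/
theorem lenOk_mem_FP {g : List Bool → List Bool} (hg : g ∈ FP) : lenOk g ∈ FP :=
  comp_mem_FP eqPairFn_mem_FP (fanoutFn_mem_FP (comp_mem_FP onesFn_mem_FP hg) (comp_mem_FP nhatF_mem_FP fstF_mem_FP))
/-- `wF ∈ FP`. [cite: AroraBarak2009, §1.3 (polynomial time is closed under composition)] -/
theorem wF_mem_FP : wF ∈ FP := comp_mem_FP fstF_mem_FP sndF_mem_FP
/-- `vF ∈ FP`. [cite: AroraBarak2009, §1.3 (polynomial time is closed under composition)] -/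
theorem vF_mem_FP : vF ∈ FP := comp_mem_FP sndF_mem_FP sndF_mem_FP
/-- `W1 ∈ FP`. [cite: AroraBarak2009, §1.3 (polynomial time is closed under composition)] -/
theorem W1_mem_FP : W1 ∈ FP :=
  andFn_mem_FP (lenOk_mem_FP (comp_mem_FP fstF_mem_FP wF_mem_FP)) (andFn_mem_FP (lenOk_mem_FP (comp_mem_FP sndF_mem_FP wF_mem_FP))
    (andFn_mem_FP (lenOk_mem_FP (comp_mem_FP fstF_mem_FP vF_mem_FP)) (lenOk_mem_FP (comp_mem_FP sndF_mem_FP vF_mem_FP))))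
/-- `Z0 ∈ FP`. [cite: AroraBarak2009, §1.3 (polynomial time is closed under composition)] -/
theorem Z0_mem_FP : Z0 ∈ FP :=
  andFn_mem_FP (comp_mem_FP eqPairFn_mem_FP (fanoutFn_mem_FP (comp_mem_FP rhatF_mem_FP fstF_mem_FP) (const_mem_FP _)))
    (andFn_mem_FP (comp_mem_FP ltFn_mem_FP (fanoutFn_mem_FP (const_mem_FP _) (comp_mem_FP (comp_mem_FP fstF_mem_FP (comp_mem_FP sndF_mem_FP fstF_mem_FP)) fstF_mem_FP)))
      (comp_mem_FP ltFn_mem_FP (fanoutFn_mem_FP (const_mem_FP _) (comp_mem_FP sndF_mem_FP fstF_mem_FP))))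
/-- `R1 ∈ FP`. [cite: AroraBarak2009, §1.3 (polynomial time is closed under composition)] -/
theorem R1_mem_FP : R1 ∈ FP :=
  notFn_mem_FP (comp_mem_FP eqPairFn_mem_FP (fanoutFn_mem_FP (comp_mem_FP rhatF_mem_FP fstF_mem_FP) (const_mem_FP _)))
/-- The row accessors are in `FP`. [cite: AroraBarak2009, §1.3 (polynomial time is closed under composition)] -/
private theorem rowAcc2i_mem_FP : (itemF ∘ fanoutFn (fstF ∘ fstF ∘ fstF) (sndF ∘ fstF)) ∈ FP :=
  comp_mem_FP itemF_mem_FP (fanoutFn_mem_FP (comp_mem_FP fstF_mem_FP (comp_mem_FP fstF_mem_FP fstF_mem_FP))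
    (comp_mem_FP sndF_mem_FP fstF_mem_FP))
/-- The row accessors are in `FP`. [cite: AroraBarak2009, §1.3 (polynomial time is closed under composition)] -/
private theorem rowAcc2j_mem_FP : (itemF ∘ fanoutFn (fstF ∘ fstF ∘ fstF) sndF) ∈ FP :=
  comp_mem_FP itemF_mem_FP (fanoutFn_mem_FP (comp_mem_FP fstF_mem_FP (comp_mem_FP fstF_mem_FP fstF_mem_FP)) sndF_mem_FP)
/-- The row accessors are in `FP`. [cite: AroraBarak2009, §1.3 (polynomial time is closed under composition)] -/
private theorem rowAcc1_mem_FP : (itemF ∘ fanoutFn (fstF ∘ fstF) sndF) ∈ FP :=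
  comp_mem_FP itemF_mem_FP (fanoutFn_mem_FP (comp_mem_FP fstF_mem_FP fstF_mem_FP) sndF_mem_FP)
/-- `soBit ∈ FP`. [cite: AroraBarak2009, §1.3 (polynomial time is closed under composition and bounded loops)] -/
theorem soBit_mem_FP : soBit ∈ FP :=
  notFn_mem_FP (spPar_mem_FP (comp_mem_FP fstF_mem_FP (comp_mem_FP fstF_mem_FP fstF_mem_FP)) rowAcc2i_mem_FP rowAcc2j_mem_FP)
/-- `soBit` is one-bit. [cite: AroraBarak2009, §1.3 (polynomial time is closed under composition)] -/
theorem oneBit_soBit : OneBit soBit := oneBit_notFn oneBit_spPar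
/-- `dBit` is one-bit. [cite: AroraBarak2009, §1.3 (polynomial time is closed under composition)] -/
theorem oneBit_dBit : OneBit dBit := oneBit_notFn oneBit_spPar
/-- `uBit` is one-bit. [cite: AroraBarak2009, §1.3 (polynomial time is closed under composition)] -/
theorem oneBit_uBit : OneBit uBit := oneBit_notFn oneBit_spPar
/-- `SO ∈ FP`. [cite: AroraBarak2009, §1.3 (polynomial time is closed under composition and bounded loops)] -/
theorem SO_mem_FP : SO ∈ FP :=
  allIdxFn_mem_FP (comp_mem_FP rhatF_mem_FP fstF_mem_FP)
    (allIdxFn_mem_FP (comp_mem_FP rhatF_mem_FP (comp_mem_FP fstF_mem_FP fstF_mem_FP)) soBit_mem_FP (oneBit_notFn oneBit_spPar))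
    (oneBit_allIdxFn (oneBit_notFn oneBit_spPar) fun u => by
      rw [Function.comp_apply, Function.comp_apply, rhatF_apply, List.length_replicate]
      exact (rhat_le _).trans ((length_fstF_le _).trans (length_fstF_le u)))
/-- `dBit ∈ FP`. [cite: AroraBarak2009, §1.3 (polynomial time is closed under composition and bounded loops)] -/
theorem dBit_mem_FP : dBit ∈ FP :=
  notFn_mem_FP (spPar_mem_FP (comp_mem_FP fstF_mem_FP fstF_mem_FP) rowAcc1_mem_FP (comp_mem_FP wF_mem_FP fstF_mem_FP))
/-- `D ∈ FP`. [cite: AroraBarak2009, §1.3 (polynomial time is closed under composition and bounded loops)] -/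
theorem D_mem_FP : D ∈ FP := allIdxFn_mem_FP (comp_mem_FP rhatF_mem_FP fstF_mem_FP) dBit_mem_FP (oneBit_notFn oneBit_spPar)
/-- `uBit ∈ FP`. [cite: AroraBarak2009, §1.3 (polynomial time is closed under composition and bounded loops)] -/
theorem uBit_mem_FP : uBit ∈ FP :=
  notFn_mem_FP (spPar_mem_FP (comp_mem_FP fstF_mem_FP fstF_mem_FP) rowAcc1_mem_FP (comp_mem_FP vF_mem_FP fstF_mem_FP))
/-- `U ∈ FP`. [cite: AroraBarak2009, §1.3 (polynomial time is closed under composition and bounded loops)] -/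
theorem U_mem_FP : U ∈ FP := allIdxFn_mem_FP (comp_mem_FP rhatF_mem_FP fstF_mem_FP) uBit_mem_FP (oneBit_notFn oneBit_spPar)
/-- `UW ∈ FP`. [cite: AroraBarak2009, §1.3 (polynomial time is closed under composition and bounded loops)] -/
theorem UW_mem_FP : UW ∈ FP := spPar_mem_FP fstF_mem_FP vF_mem_FP wF_mem_FP
/-- `wtBit ∈ FP`. [cite: AroraBarak2009, §1.3 (polynomial time is closed under composition)] -/
theorem wtBit_mem_FP : wtBit ∈ FP := orFn_mem_FP (bitK_mem_FP fstF_mem_FP wF_mem_FP) (bitK_mem_FP sndF_mem_FP wF_mem_FP)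
/-- `wtBit` is one-bit. [cite: AroraBarak2009, §1.3 (polynomial time is closed under composition)] -/
theorem oneBit_wtBit : OneBit wtBit := oneBit_orFn (oneBit_headBitFn.comp _) (oneBit_headBitFn.comp _)
/-- `wtSum ∈ FP`. [cite: AroraBarak2009, §1.3 (polynomial time is closed under composition and bounded loops)] -/
theorem wtSum_mem_FP : wtSum ∈ FP :=
  comp_mem_FP (sndPow_mem_FP 2) (comp_mem_FP
    (foldLoop_mem_FP addFn_mem_FP length_addFn_le wtBit_mem_FP (length_le_of_oneBit oneBit_wtBit) X)
    (fanoutFn_mem_FP OracleCompose.id_mem_FP (fanoutFn_mem_FP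
      (comp_mem_FP lenBinF_mem_FP (comp_mem_FP nhatF_mem_FP fstF_mem_FP)) (const_mem_FP _))))
/-- `WT ∈ FP`. [cite: AroraBarak2009, §1.3 (polynomial time is closed under composition and bounded loops)] -/
theorem WT_mem_FP : WT ∈ FP := notFn_mem_FP (comp_mem_FP ltFn_mem_FP (fanoutFn_mem_FP (comp_mem_FP sndF_mem_FP fstF_mem_FP) wtSum_mem_FP))
/-- **`V ∈ FP`.** [cite: AroraBarak2009, §1.3 (polynomial time is closed under composition and bounded loops)] -/
theorem V_mem_FP : V ∈ FP :=
  andFn_mem_FP (comp_mem_FP T_mem_FP fstF_mem_FP) (orFn_mem_FP Z0_mem_FP (andFn_mem_FP R1_mem_FP (andFn_mem_FP W1_mem_FP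
    (andFn_mem_FP SO_mem_FP (andFn_mem_FP D_mem_FP (andFn_mem_FP U_mem_FP (andFn_mem_FP UW_mem_FP WT_mem_FP)))))))

/-- `W1` is one-bit. [cite: AroraBarak2009, §1.3 (polynomial time is closed under composition)] -/
theorem oneBit_W1 : OneBit W1 :=
  oneBit_andFn (oneBit_eqPairFn.comp _) (oneBit_andFn (oneBit_eqPairFn.comp _)
    (oneBit_andFn (oneBit_eqPairFn.comp _) (oneBit_eqPairFn.comp _)))
/-- `Z0` is one-bit. [cite: AroraBarak2009, §1.3 (polynomial time is closed under composition)] -/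
theorem oneBit_Z0 : OneBit Z0 := oneBit_andFn (oneBit_eqPairFn.comp _) (oneBit_andFn (oneBit_ltFn.comp _) (oneBit_ltFn.comp _))
/-- `R1` is one-bit. [cite: AroraBarak2009, §1.3 (polynomial time is closed under composition)] -/
theorem oneBit_R1 : OneBit R1 := oneBit_notFn (oneBit_eqPairFn.comp _)
/-- `SO` is one-bit. [cite: AroraBarak2009, §1.3 (polynomial time is closed under composition)] -/
theorem oneBit_SO : OneBit SO :=
  oneBit_allIdxFn (oneBit_allIdxFn (oneBit_notFn oneBit_spPar) fun u => by
      rw [Function.comp_apply, Function.comp_apply, rhatF_apply, List.length_replicate]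
      exact (rhat_le _).trans ((length_fstF_le _).trans (length_fstF_le u)))
    fun u => by
      rw [Function.comp_apply, rhatF_apply, List.length_replicate]
      exact (rhat_le _).trans (length_fstF_le u)
/-- `D` is one-bit. [cite: AroraBarak2009, §1.3 (polynomial time is closed under composition)] -/
theorem oneBit_D : OneBit D :=
  oneBit_allIdxFn (oneBit_notFn oneBit_spPar) fun u => by
    rw [Function.comp_apply, rhatF_apply, List.length_replicate]; exact (rhat_le _).trans (length_fstF_le u)
/-- `U` is one-bit. [cite: AroraBarak2009, §1.3 (polynomial time is closed under composition)] -/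
theorem oneBit_U : OneBit U :=
  oneBit_allIdxFn (oneBit_notFn oneBit_spPar) fun u => by
    rw [Function.comp_apply, rhatF_apply, List.length_replicate]; exact (rhat_le _).trans (length_fstF_le u)
/-- `WT` is one-bit. [cite: AroraBarak2009, §1.3 (polynomial time is closed under composition)] -/
theorem oneBit_WT : OneBit WT := oneBit_notFn (oneBit_ltFn.comp _)
/-- The certificate branch is one-bit. [cite: AroraBarak2009, §1.3 (polynomial time is closed under composition)] -/
theorem oneBit_branch : OneBit (andFn R1 (andFn W1 (andFn SO (andFn D (andFn U (andFn UW WT)))))) :=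
  oneBit_andFn oneBit_R1 (oneBit_andFn oneBit_W1 (oneBit_andFn oneBit_SO (oneBit_andFn oneBit_D
    (oneBit_andFn oneBit_U (oneBit_andFn oneBit_spPar oneBit_WT)))))
/-- **`V` is one-bit.** [cite: AroraBarak2009, §1.3 (polynomial time is closed under composition)] -/
theorem oneBit_V : OneBit V := oneBit_andFn (oneBit_T.comp _) (oneBit_orFn oneBit_Z0 oneBit_branch)

/-! ### Values of the checks -/

section Values

variable (x c : List Bool)

/-- The error's X-part bits `a` in a certificate `c = ⟨⟨a, b⟩, ⟨a', b'⟩⟩` (junk-tolerant). [folklore] -/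
def cA (c : List Bool) : List Bool := fstF (fstF c)
/-- The error's Z-part bits `b`. [folklore] -/
def cB (c : List Bool) : List Bool := sndF (fstF c)
/-- The dual witness's X-part bits `a'`. [folklore] -/
def cA' (c : List Bool) : List Bool := fstF (sndF c)
/-- The dual witness's Z-part bits `b'`. [folklore] -/
def cB' (c : List Bool) : List Bool := sndF (sndF c)

/-- The verifier's input `u = ⟨x, c⟩`. [folklore] -/
def uRec (x c : List Bool) : List Bool := boolPair x c

/-- Value of `wF`. [folklore] -/
private theorem wF_uRec : wF (uRec x c) = fstF c := by simp [wF, uRec]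
/-- Value of `vF`. [folklore] -/
private theorem vF_uRec : vF (uRec x c) = sndF c := by simp [vF, uRec]
/-- Value of `fstF`. [folklore] -/
private theorem fstF_uRec : fstF (uRec x c) = x := by simp [uRec]

/-- Value of `lenOk`. [folklore] -/
private theorem lenOk_apply (g : List Bool → List Bool) (u : List Bool) : lenOk g u = [decide ((g u).length = nhat (fstF u))] := by
  rw [lenOk, Function.comp_apply, fanoutFn_apply, Function.comp_apply, ThreeDMNP.onesFn_eq_ones, Function.comp_apply, nhatF_apply,
    eqPairFn_boolPair, decide_ones_eq_ones]

/-- Value of `W1`. [cite: AroraBarak2009, §1.3 (composition of polynomial-time string functions)] -/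
theorem W1_apply : W1 (uRec x c) =
    [decide ((cA c).length = nhat x) && (decide ((cB c).length = nhat x) &&
      (decide ((cA' c).length = nhat x) && decide ((cB' c).length = nhat x)))] := by
  rw [W1, andFn_apply (lenOk_apply _ _) (andFn_apply (lenOk_apply _ _) (andFn_apply (lenOk_apply _ _) (lenOk_apply _ _)))]
  simp only [Function.comp_apply, wF_uRec, vF_uRec, fstF_uRec]
  rfl

/-- Value of `Z0`: the row-free test `r = 0 ∧ 0 < n ∧ 0 < t`. [cite: KapshikarKundu2023, §3 Problem 4; AroraBarak2009, §1.3] -/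
theorem Z0_apply : Z0 (uRec x c) = [decide (rhat x = 0) && (decide (0 < nOf x) && decide (0 < tOf x))] := by
  have h1 : (eqPairFn ∘ fanoutFn (rhatF ∘ fstF) (fun _ => [])) (uRec x c) = [decide (rhat x = 0)] := by
    rw [Function.comp_apply, fanoutFn_apply, Function.comp_apply, fstF_uRec, rhatF_apply, eqPairFn_boolPair, decide_ones_eq_nil]
  have h2 : (ltFn ∘ fanoutFn (fun _ => []) (nnF ∘ fstF)) (uRec x c) = [decide (0 < nOf x)] := by
    rw [Function.comp_apply, fanoutFn_apply, Function.comp_apply, fstF_uRec, ltFn_boolPair, bitsToNat_nil]; rfl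
  have h3 : (ltFn ∘ fanoutFn (fun _ => []) (sndF ∘ fstF)) (uRec x c) = [decide (0 < tOf x)] := by
    rw [Function.comp_apply, fanoutFn_apply, Function.comp_apply, fstF_uRec, ltFn_boolPair, bitsToNat_nil]; rfl
  rw [Z0, andFn_apply h1 (andFn_apply h2 h3)]

/-- Value of `R1`. [cite: AroraBarak2009, §1.3 (composition of polynomial-time string functions)] -/
theorem R1_apply : R1 (uRec x c) = [!decide (rhat x = 0)] := by
  have h1 : (eqPairFn ∘ fanoutFn (rhatF ∘ fstF) (fun _ => [])) (uRec x c) = [decide (rhat x = 0)] := by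
    rw [Function.comp_apply, fanoutFn_apply, Function.comp_apply, fstF_uRec, rhatF_apply, eqPairFn_boolPair, decide_ones_eq_nil]
  rw [R1, notFn_apply h1]

/-- Value of `soBit`. [folklore] -/
private theorem soBit_apply (i j : ℕ) :
    soBit (boolPair (boolPair (uRec x c) (ones i)) (ones j)) =
      [!decide (spNat (aIt x i) (bIt x i) (aIt x j) (bIt x j) (nhat x) % 2 = 1)] := by
  rw [soBit, notFn_apply (spPar_apply _ (by
    simp only [Function.comp_apply, fstF_boolPair, fstF_uRec, length_boolPair]
    have := nhat_le x
    have : x.length ≤ (uRec x c).length := by rw [uRec, length_boolPair]; omega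
    omega))]
  simp only [Function.comp_apply, fanoutFn_apply, fstF_boolPair, sndF_boolPair, fstF_uRec, itemF_apply, aIt, bIt]
  rfl

/-- Value of `SO`: all pairs of rows have even symplectic pairing. [cite: KapshikarKundu2023, §2.2.1; AroraBarak2009, §1.3 (bounded loops)] -/
theorem SO_apply : SO (uRec x c) =
    [decide (∀ i < rhat x, ∀ j < rhat x, decide (spNat (aIt x i) (bIt x i) (aIt x j) (bIt x j) (nhat x) % 2 = 1) = false)] := by
  have hin : ∀ i, allIdxFn (rhatF ∘ fstF ∘ fstF) soBit (boolPair (uRec x c) (ones i)) =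
      [decide (∀ j < rhat x, decide (spNat (aIt x i) (bIt x i) (aIt x j) (bIt x j) (nhat x) % 2 = 1) = false)] := fun i => by
    rw [allIdxFn_apply oneBit_soBit (h := rhatF ∘ fstF ∘ fstF)
      (by rw [Function.comp_apply, Function.comp_apply, fstF_boolPair, fstF_uRec, rhatF_apply, List.length_replicate,
            length_boolPair, uRec, length_boolPair]; have := rhat_le x; omega)]
    simp only [Function.comp_apply, fstF_boolPair, fstF_uRec, rhatF_apply, List.length_replicate, soBit_apply]
    simp
  rw [SO, allIdxFn_apply (oneBit_allIdxFn oneBit_soBit fun u => by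
      rw [Function.comp_apply, Function.comp_apply, rhatF_apply, List.length_replicate]
      exact (rhat_le _).trans ((length_fstF_le _).trans (length_fstF_le u))) (h := rhatF ∘ fstF)
    (by rw [Function.comp_apply, fstF_uRec, rhatF_apply, List.length_replicate, uRec, length_boolPair]; have := rhat_le x; omega)]
  simp only [Function.comp_apply, fstF_uRec, rhatF_apply, List.length_replicate, hin]
  simp

/-- Value of `dBit`. [folklore] -/
private theorem dBit_apply (i : ℕ) :
    dBit (boolPair (uRec x c) (ones i)) = [!decide (spNat (aIt x i) (bIt x i) (cA c) (cB c) (nhat x) % 2 = 1)] := by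
  rw [dBit, notFn_apply (spPar_apply _ (by
    simp only [Function.comp_apply, fstF_boolPair, fstF_uRec, length_boolPair]
    have := nhat_le x
    have : x.length ≤ (uRec x c).length := by rw [uRec, length_boolPair]; omega
    omega))]
  simp only [Function.comp_apply, fanoutFn_apply, fstF_boolPair, sndF_boolPair, fstF_uRec, wF_uRec, itemF_apply, aIt, bIt]
  rfl

/-- Value of `D`: the error has even pairing with every row. [cite: KapshikarKundu2023, §3 Problem 4; AroraBarak2009, §1.3 (bounded loops)] -/
theorem D_apply : D (uRec x c) = [decide (∀ i < rhat x, decide (spNat (aIt x i) (bIt x i) (cA c) (cB c) (nhat x) % 2 = 1) = false)] := by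
  rw [D, allIdxFn_apply oneBit_dBit (h := rhatF ∘ fstF)
    (by rw [Function.comp_apply, fstF_uRec, rhatF_apply, List.length_replicate, uRec, length_boolPair]; have := rhat_le x; omega)]
  simp only [Function.comp_apply, fstF_uRec, rhatF_apply, List.length_replicate, dBit_apply]
  simp

/-- Value of `uBit`. [folklore] -/
private theorem uBit_apply (i : ℕ) :
    uBit (boolPair (uRec x c) (ones i)) = [!decide (spNat (aIt x i) (bIt x i) (cA' c) (cB' c) (nhat x) % 2 = 1)] := by
  rw [uBit, notFn_apply (spPar_apply _ (by
    simp only [Function.comp_apply, fstF_boolPair, fstF_uRec, length_boolPair]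
    have := nhat_le x
    have : x.length ≤ (uRec x c).length := by rw [uRec, length_boolPair]; omega
    omega))]
  simp only [Function.comp_apply, fanoutFn_apply, fstF_boolPair, sndF_boolPair, fstF_uRec, vF_uRec, itemF_apply, aIt, bIt]
  rfl

/-- Value of `U`: the dual witness has even pairing with every row. [cite: AroraBarak2009, §1.3 (bounded loops)] -/
theorem U_apply : U (uRec x c) = [decide (∀ i < rhat x, decide (spNat (aIt x i) (bIt x i) (cA' c) (cB' c) (nhat x) % 2 = 1) = false)] := by
  rw [U, allIdxFn_apply oneBit_uBit (h := rhatF ∘ fstF)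
    (by rw [Function.comp_apply, fstF_uRec, rhatF_apply, List.length_replicate, uRec, length_boolPair]; have := rhat_le x; omega)]
  simp only [Function.comp_apply, fstF_uRec, rhatF_apply, List.length_replicate, uBit_apply]
  simp

/-- Value of `UW`: the dual witness has odd pairing with the error. [cite: CalderbankEtAl1998, §2 eq. (1) (printed p. 4); AroraBarak2009, §1.3] -/
theorem UW_apply : UW (uRec x c) = [decide (spNat (cA' c) (cB' c) (cA c) (cB c) (nhat x) % 2 = 1)] := by
  rw [UW, spPar_apply _ (by rw [fstF_uRec, uRec, length_boolPair]; have := nhat_le x; omega)]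
  simp only [fstF_uRec, vF_uRec, wF_uRec]
  rfl

/-- Value of `wtBit`. [folklore] -/
private theorem wtBit_apply (k : ℕ) : wtBit (boolPair (uRec x c) (ones k)) = [(cA c).getD k false || (cB c).getD k false] := by
  rw [wtBit, orFn_apply (bitK_apply _ _ _ k) (bitK_apply _ _ _ k), wF_uRec]
  rfl

/-- Value of `wtSum`. [folklore] -/
private theorem wtSum_apply : wtSum (uRec x c) = encodeNat (wtNat (cA c) (cB c) (nhat x)) := by
  have hinit : spInit fstF (uRec x c) =
      boolPair (uRec x c) (boolPair (encodeNat (nhat x)) (boolPair (ones 0) (encodeNat 0))) := by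
    simp only [spInit, fanoutFn_apply, id, Function.comp_apply, fstF_uRec, nhatF_apply, lenBinF_apply, List.length_replicate]; rfl
  have hk : nhat x ≤ (X : Polynomial ℕ).eval (uRec x c).length := by
    rw [eval_X, uRec, length_boolPair]; have := nhat_le x; omega
  rw [wtSum, Function.comp_apply, Function.comp_apply, hinit, foldLoop_apply addFn wtBit hk 0 (encodeNat 0), foldAcc_addFn]
  simp only [sndPow, Function.comp_apply, sndF_boolPair, Nat.zero_add, wtBit_apply, bitsToNat_single, wtNat]

/-- Value of `WT`: `[wt(a|b) ≤ t]`. [cite: KapshikarKundu2023, §3 Problem 4 ("of weight ≤ t"); AroraBarak2009, §1.3 (bounded loops)] -/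
theorem WT_apply : WT (uRec x c) = [!decide (tOf x < wtNat (cA c) (cB c) (nhat x))] := by
  rw [WT, notFn_apply]
  rw [Function.comp_apply, fanoutFn_apply, Function.comp_apply, fstF_uRec, wtSum_apply, ltFn_boolPair, bitsToNat_encodeNat]; rfl

/-- **Value of the verifier.** [cite: KapshikarKundu2023, §3 (after Problem 4)] -/
theorem V_eq_true_iff : V (uRec x c) = [true] ↔
    GoodShape x ∧ ((rhat x = 0 ∧ 0 < nOf x ∧ 0 < tOf x) ∨
      (rhat x ≠ 0 ∧ ((cA c).length = nhat x ∧ (cB c).length = nhat x ∧ (cA' c).length = nhat x ∧ (cB' c).length = nhat x) ∧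
        (∀ i < rhat x, ∀ j < rhat x, decide (spNat (aIt x i) (bIt x i) (aIt x j) (bIt x j) (nhat x) % 2 = 1) = false) ∧
        (∀ i < rhat x, decide (spNat (aIt x i) (bIt x i) (cA c) (cB c) (nhat x) % 2 = 1) = false) ∧
        (∀ i < rhat x, decide (spNat (aIt x i) (bIt x i) (cA' c) (cB' c) (nhat x) % 2 = 1) = false) ∧
        decide (spNat (cA' c) (cB' c) (cA c) (cB c) (nhat x) % 2 = 1) = true ∧ wtNat (cA c) (cB c) (nhat x) ≤ tOf x)) := by
  rw [V, andFn_eq_true_iff (oneBit_T.comp fstF) (oneBit_orFn oneBit_Z0 oneBit_branch), Function.comp_apply,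
    show fstF (uRec x c) = x from fstF_uRec x c, T_eq_true_iff,
    orFn_eq_true_iff oneBit_Z0 oneBit_branch, Z0_apply,
    andFn_apply (R1_apply x c) (andFn_apply (W1_apply x c) (andFn_apply (SO_apply x c)
      (andFn_apply (D_apply x c) (andFn_apply (U_apply x c) (andFn_apply (UW_apply x c)
        (WT_apply x c))))))]
  simp only [List.cons.injEq, and_true, Bool.and_eq_true, Bool.not_eq_true', decide_eq_false_iff_not, not_lt,
    decide_eq_true_eq]

end Values

/-! ### Soundness and completeness -/

/-- A single-qubit `X` error has weight `≤ 1`. [folklore] -/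
private theorem sympWeight_single_le {N : ℕ} (i : Fin N) : sympWeight ((Pi.single i 1, 0) : SympVec N) ≤ 1 := by
  rw [sympWeight_mk_zero_snd]
  unfold hammingNorm
  refine Finset.card_le_one.2 fun j hj k hk => ?_
  rw [Finset.mem_filter] at hj hk
  by_contra hjk
  rcases eq_or_ne j i with rfl | hji
  · exact hk.2 (Pi.single_eq_of_ne (Ne.symm hjk) _)
  · exact hj.2 (Pi.single_eq_of_ne hji _)

/-- Rows of a code read back as symplectic vectors. [cite: KapshikarKundu2023, §2.2.1 (rows (a|b) of S)] -/
theorem svecOf_aIt_bIt (I : (Σ r : ℕ, Σ n : ℕ, Fin r → SympVec n) × ℕ) (i : Fin I.1.1) :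
    svecOf I.1.2.1 (aIt ((encodingSympRows.pairBool encodingNatBool).encode I) i)
      (bIt ((encodingSympRows.pairBool encodingNatBool).encode I) i) = I.1.2.2 i := by
  rw [aIt, bIt, item_encode, rowCode_of_lt, fstF_boolPair, sndF_boolPair, encode_eq_bitsOf, encode_eq_bitsOf,
    svecOf_bitsOf]

/-- Reading a structured certificate. [folklore] -/
private theorem cA_pair (a b v : List Bool) : cA (boolPair (boolPair a b) v) = a := by
  rw [cA, fstF_boolPair, fstF_boolPair]
/-- Reading a structured certificate. [folklore] -/
private theorem cB_pair (a b v : List Bool) : cB (boolPair (boolPair a b) v) = b := by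
  rw [cB, fstF_boolPair, sndF_boolPair]
/-- Reading a structured certificate. [folklore] -/
private theorem cA'_pair (v a b : List Bool) : cA' (boolPair v (boolPair a b)) = a := by
  rw [cA', sndF_boolPair, fstF_boolPair]
/-- Reading a structured certificate. [folklore] -/
private theorem cB'_pair (v a b : List Bool) : cB' (boolPair v (boolPair a b)) = b := by
  rw [cB', sndF_boolPair, sndF_boolPair]

/-- **Soundness**: an accepted pair `⟨x, c⟩` has `x ∈ QMINDIST`. In the row-free case the single-qubit
error `X₁` is undetectable of weight `1 ≤ t`; otherwise the rows pairwise commute, the error `w = (a|b)`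
lies in `S̄⊥`, and the dual witness `u ∈ S̄⊥` with `(u, w) = 1` forbids `w ∈ S̄` (every element of `S̄`
is orthogonal to `S̄⊥`). [cite: KapshikarKundu2023, §3 (after Problem 4: "it is easy to see that QMD is in NP")] -/
theorem mem_of_accepts {x c : List Bool} (h : V (boolPair x c) = [true]) : x ∈ QMINDIST := by
  obtain ⟨hG, hcase⟩ := (V_eq_true_iff x c).1 h
  obtain ⟨hr, hn⟩ := clamps_of_goodShape hG
  rw [← encode_instOf hG, QMINDIST, Computability.Encoding.mem_toLanguage_iff]
  show IsSelfOrthogonal (rowSpan (rowsOf x)) ∧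
    ∃ w ∈ sympDual (rowSpan (rowsOf x)), w ∉ rowSpan (rowsOf x) ∧ sympWeight w ≤ tOf x
  rcases hcase with ⟨hr0, hn0, ht0⟩ | ⟨hr0, -, hSO, hD, hU, hUW, hWT⟩
  · have h00 : rOf x = 0 := by rw [← hr]; exact hr0
    haveI : IsEmpty (Fin (rOf x)) := ⟨fun i => absurd i.2 (by omega)⟩
    have hbot : rowSpan (rowsOf x) = ⊥ := by rw [rowSpan, Set.range_eq_empty, Submodule.span_empty]
    rw [hbot, sympDual_bot]
    refine ⟨?_, (Pi.single ⟨0, hn0⟩ 1, 0), Submodule.mem_top, fun hmem => ?_, (sympWeight_single_le _).trans ht0⟩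
    · show (⊥ : Submodule (ZMod 2) (SympVec (nOf x))) ≤ sympDual ⊥
      exact bot_le
    · have hpair := (Submodule.mem_bot (ZMod 2)).1 hmem
      have h1 : (Pi.single (⟨0, hn0⟩ : Fin (nOf x)) (1 : ZMod 2) : Fin (nOf x) → ZMod 2) ⟨0, hn0⟩ = 0 := by
        have h := congrFun (Prod.ext_iff.1 hpair).1 ⟨0, hn0⟩
        exact h
      rw [Pi.single_eq_same] at h1
      exact one_ne_zero h1
  · have hnn : nhat x = nOf x := hn (Nat.pos_of_ne_zero hr0)
    rw [hnn] at hSO hD hU hUW hWT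
    rw [hr] at hSO hD hU
    refine ⟨(isSelfOrthogonal_span_range_iff (rowsOf x)).2 fun i j =>
        (sympInner_svecOf_eq_zero_iff _ _ _ _ _).2 (hSO i i.2 j j.2),
      svecOf (nOf x) (cA c) (cB c),
      (mem_sympDual_span_range_iff (rowsOf x) _).2 fun i => (sympInner_svecOf_eq_zero_iff _ _ _ _ _).2 (hD i i.2),
      fun hw => ?_, by rw [← wtNat_eq_sympWeight]; exact hWT⟩
    have hu := (mem_sympDual_span_range_iff (rowsOf x) (svecOf (nOf x) (cA' c) (cB' c))).2
      fun i => (sympInner_svecOf_eq_zero_iff _ _ _ _ _).2 (hU i i.2)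
    have h0 := mem_sympDual_iff.1 hu _ hw
    rw [sympInner_comm] at h0
    exact (sympInner_svecOf_ne_zero_iff _ _ _ _ _).2 hUW h0

/-- **Completeness**: a yes-instance has a short accepted certificate — the bits of an undetectable error
`w ∈ S̄⊥ ∖ S̄` of weight `≤ t` together with a dual witness `u ∈ S̄⊥`, `(u, w) = 1`, which exists because
`S̄⊥⊥ = S̄` (`sympDual_sympDual`); length `9n + 8 ≤ 9|x| + 8`. [cite: KapshikarKundu2023, §3 (after Problem 4: "it is easy to see that QMD is in NP")] -/
theorem accepts_of_mem (I : (Σ r : ℕ, Σ n : ℕ, Fin r → SympVec n) × ℕ) (hI : I ∈ quantumMinimumDistanceSet) :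
    ∃ c : List Bool, c.length ≤ 9 * ((encodingSympRows.pairBool encodingNatBool).encode I).length + 8 ∧
      V (boolPair ((encodingSympRows.pairBool encodingNatBool).encode I) c) = [true] := by
  obtain ⟨hso, w, hw, hwS, hwt⟩ := hI
  obtain ⟨hrh, hnh⟩ := clamps_encode I
  obtain ⟨-, h2, h3, -⟩ := fields_encode I
  have hw0 : w ≠ 0 := fun h => hwS (by rw [h]; exact Submodule.zero_mem _)
  have hw1 : 1 ≤ sympWeight w := Nat.one_le_iff_ne_zero.2 fun h0 => hw0 ((sympWeight_eq_zero_iff w).1 h0)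
  have hn0 : 0 < I.1.2.1 := hw1.trans (sympWeight_le w)
  have ht0 : 0 < I.2 := hw1.trans hwt
  rcases Nat.eq_zero_or_pos I.1.1 with hr | hr
  · refine ⟨[], by simp, ?_⟩
    show V (uRec _ _) = [true]
    rw [V_eq_true_iff, hrh, h2, h3]
    exact ⟨goodShape_encode I, Or.inl ⟨hr, hn0, ht0⟩⟩
  · have hex : ∃ u ∈ sympDual (rowSpan I.1.2.2), sympInner u w ≠ 0 := by
      by_contra hcon
      refine hwS ?_
      rw [← sympDual_sympDual (rowSpan I.1.2.2), mem_sympDual_iff]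
      intro u hu
      by_contra huw
      exact hcon ⟨u, hu, huw⟩
    obtain ⟨u, hu, huw⟩ := hex
    refine ⟨boolPair (boolPair (bitsOf w.1) (bitsOf w.2)) (boolPair (bitsOf u.1) (bitsOf u.2)), ?_, ?_⟩
    · have hnl := n_le_length_encode I hr
      simp only [length_boolPair, length_bitsOf]
      omega
    · show V (uRec _ _) = [true]
      rw [V_eq_true_iff, hrh, hnh hr, h2, h3, cA_pair, cB_pair, cA'_pair, cB'_pair]
      refine ⟨goodShape_encode I, Or.inr ⟨hr.ne', ⟨length_bitsOf _, length_bitsOf _, length_bitsOf _, length_bitsOf _⟩,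
        fun i hi j hj => ?_, fun i hi => ?_, fun i hi => ?_, ?_, ?_⟩⟩
      · rw [← sympInner_svecOf_eq_zero_iff, svecOf_aIt_bIt I ⟨i, hi⟩, svecOf_aIt_bIt I ⟨j, hj⟩]
        exact (isSelfOrthogonal_span_range_iff I.1.2.2).1 hso ⟨i, hi⟩ ⟨j, hj⟩
      · rw [← sympInner_svecOf_eq_zero_iff, svecOf_aIt_bIt I ⟨i, hi⟩, svecOf_bitsOf]
        exact (mem_sympDual_span_range_iff I.1.2.2 w).1 hw ⟨i, hi⟩
      · rw [← sympInner_svecOf_eq_zero_iff, svecOf_aIt_bIt I ⟨i, hi⟩, svecOf_bitsOf]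
        exact (mem_sympDual_span_range_iff I.1.2.2 u).1 hu ⟨i, hi⟩
      · rw [← sympInner_svecOf_ne_zero_iff, svecOf_bitsOf, svecOf_bitsOf]
        exact huw
      · rw [wtNat_eq_sympWeight, svecOf_bitsOf]
        exact hwt

/-! ### `QMINDIST ∈ NP` -/

/-- The verifier's language. [cite: KapshikarKundu2023, §3 (after Problem 4)] -/
def Rlang : Language Bool := {u | V u = [true]}

/-- **`Rlang ∈ P`.** [cite: AroraBarak2009, Def. 1.13] -/
theorem Rlang_mem_P : Rlang ∈ Classes.P :=
  mem_P_of_mem_FP V_mem_FP _ fun u =>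
    ⟨fun h => h, fun h => by
      obtain ⟨b, hb⟩ := oneBit_V u
      cases b
      · exact hb
      · exact absurd hb h⟩

/-- **QMD (stabilizer-generator input `S ∈ 𝔽₂^{r×2n}`, bound `t`) is in `NP`** — "Like MD, it is easy to
see that QMD is in NP": guess an error `w = (a|b)` and a dual witness `u`; the verifier `V` checks in
polynomial time that the input codes an instance, that the rows commute, `w ∈ S̄⊥`, `u ∈ S̄⊥`, `(u,w) = 1`
(so `w ∉ S̄`), and `wt(w) ≤ t`; certificate length `≤ 9|x| + 8`.
[cite: KapshikarKundu2023, §3 (after Problem 4: "Like MD, it is easy to see that QMD is in NP"); AroraBarak2009, Def. 2.1] -/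
theorem QMINDIST_mem_NP : QMINDIST ∈ Nondeterministic.NP := by
  refine ⟨Rlang, Rlang_mem_P, 9 * X + 8, fun x => ⟨?_, ?_⟩⟩
  · rintro ⟨I, hI, rfl⟩
    obtain ⟨c, hc, hV⟩ := accepts_of_mem I hI
    exact ⟨c, by simp only [eval_add, eval_mul, eval_ofNat, eval_X]; exact hc, hV⟩
  · rintro ⟨c, -, hc⟩
    exact mem_of_accepts hc

end QMinDistNP

/-- **Kapshikar–Kundu 2023, Theorem 2 (first clause, as printed): "QMD is NP-complete"** — for the
standard stabilizer-generator input (§2.2.1, §4.1: "our hardness results from Theorem 2 translate to the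
standard input of the stabilizer framework as well"): `QMINDIST ∈ NP` (`QMinDistNP.QMINDIST_mem_NP`, the
membership the authors call "easy to see", §3) and `QMINDIST` is NP-hard
(`KapshikarKundu2023_quantumMinimumDistance_isNPHard_holds`, `StabilizerDistanceHardness.lean`, by
`COSETWEIGHTS ≤ₚ QMINDIST`). [cite: KapshikarKundu2023, §4 Theorem 2 ("QMD is NP-complete") with §3 (remark after Problem 4) and §4.1] -/
theorem KapshikarKundu2023_quantumMinimumDistance_isNPComplete : IsNPComplete QMINDIST :=
  ⟨QMinDistNP.QMINDIST_mem_NP, KapshikarKundu2023_quantumMinimumDistance_isNPHard_holds⟩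

end Literature.InformationTheory.QuantumCodes

end
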